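import Summits.SmoothPoincare4.SmoothPoincare4.Theses.CongruenceShadows
import Summits.SmoothPoincare4.SmoothPoincare4.Theorems.NilpotentShadowsStandard.Negative.LoadBearing

/-!
# Negative lemmas for the crux `ShadowsStandard` (item stmt-SmoothPoincare4-14593): levels, kill criterion, load-bearing hypotheses

Refuter negative lemmas (cdisprove seat, route `CongruenceShadows`, crux
`Summit.SmoothPoincare4.SmoothPoincare4.Theses.CongruenceShadows.ShadowsStandard`: for every `m`,
every `(3+3m, m+1)` group trisection `K` of the trivial group and every characteristic
finite-index `M ≤ S_{3+3m}` some automorphism `ψ` of the surface group has `ψ(Nᵢ)·M = Kᵢ·M`,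
`N = s4Kernels.stabilizeIter m`). Nothing here asserts the crux; everything is sorry-free over
`GroupTrisections.lean` + Mathlib (the character lemma `lift_surfaceRelator_eq_one` is reused from the
sibling `NilpotentShadowsStandard/Negative/LoadBearing.lean`).

## Content

* §0 `ShadowStandardAt m K M` (the level-`M` conclusion of the crux),
  `stabilizeIter_isGroupTrisection` (hypotheses satisfiable). "Unstable standardness" below
  means `Iso N K` for every balanced group trisection `K` of `{1}` (= SPC4 ∧ balanced 4-d
  Waldhausen in AGK's dictionary); it is written out, never named (no `def : Prop` here).
* §1 `exists_nonstandard_of_not_shadowsStandard`: a failure of the crux is a balanced group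
  trisection of `{1}` NOT isomorphic to the standard one at its genus (so: an exotic `S⁴` or a
  non-standard balanced trisection of `S⁴`, Meier–Schirmer–Zupan Conj. 3.11) — why it resists.
* §2 the verbal levels `levelSubgroup g Q = ⋂ ker (S_g →* Q)`: characteristic, finite index for
  finite `Q`, cofinal (`levelSubgroup_quotient_le`); `ShadowStandardAt.mono`; the crux implies its
  level form (`shadowsStandard_levels`).
* §3 the computable KILL CRITERION `homShadow_equiv_of_shadowStandardAt` / `card_homShadow_eq`:
  a standard shadow at level `M_Q` makes the `Hom(S,Q)`-labellings `φ ↦ (φ(Kᵢ))ᵢ` of `K` and `N`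
  isomorphic, so all exact-image counts agree; one finite `Q` and one kernel-form candidate `K`
  with a differing count refute the crux.
* §4 load-bearing hypotheses: `shadowsStandard_false_without_trisection` (drop
  `IsGroupTrisection`: `K = ⊥`, `M = M_{ℤ/2}`), `shadowsStandard_false_without_characteristic`
  (drop `Characteristic`: the relabelled standard triple `N ∘ finRotate 3` and `M = ker χ_{b₂}`),
  `shadowsStandard_without_finiteIndex_iff_unstable` (drop `FiniteIndex`: equivalent to unstable
  standardness, open).
* §5 `shadowsStandard_uniform_iff_unstable`: the strengthening "one `ψ` for all levels" is
  unstable standardness.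

Sources: Abrams–Gay–Kirby 2018 (arXiv:1605.06731) Thm 5 / Cor 6 for the dictionary;
Meier–Schirmer–Zupan 2016 (arXiv:1507.06561) Conj. 3.11; Aranda–Zupan 2025 (arXiv:2503.04607)
p. 27 for the status of non-standard trisections of `S⁴` (candidates only).
-/

noncomputable section

namespace Summit.SmoothPoincare4.SmoothPoincare4.Theorems.ShadowsStandard.Negative

open Literature.Topology.FourManifolds Subgroup
open Summit.SmoothPoincare4.SmoothPoincare4.Theses.CongruenceShadows (ShadowsStandard)

/-! ## §0 Notation: the standard triple and level-wise standardness -/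

/-- The standard balanced `(3+3m, m+1)` triple `N = s4Kernels.stabilizeIter m`. [folklore] -/
abbrev N (m : ℕ) : TrisectionKernels (3 + 3 * m) := s4Kernels.stabilizeIter m

/-- "The shadow of `K` at level `M` is standard": some automorphism of `S` carries
`Nᵢ ⊔ M` to `Kᵢ ⊔ M` for all three `i`. [folklore] -/
def ShadowStandardAt (m : ℕ) (K : TrisectionKernels (3 + 3 * m))
    (M : Subgroup (SurfaceGroup (3 + 3 * m))) : Prop :=
  ∃ ψ : SurfaceGroup (3 + 3 * m) ≃* SurfaceGroup (3 + 3 * m),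
    ∀ i : Fin 3, (N m i ⊔ M).map ψ.toMonoidHom = K i ⊔ M

/-- The standard triple is a group trisection of the trivial group at every `m` (the crux's
hypotheses are satisfiable; from the two discharged tree facts). [folklore] -/
theorem stabilizeIter_isGroupTrisection (m : ℕ) :
    IsGroupTrisection (3 + 3 * m) (m + 1) (PUnit : Type) (N m) := by
  induction m with
  | zero => exact s4Kernels_isGroupTrisection_holds
  | succ m ih => exact stabilize_isGroupTrisection_holds (3 + 3 * m) (m + 1) PUnit (N m) ih

/-! ## §1 Where a counterexample must live: unstable standardness implies the crux -/

/-- An isomorphism of triples gives standard shadows at every characteristic level. [folklore] -/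
theorem ShadowStandardAt.of_iso {m : ℕ} {K : TrisectionKernels (3 + 3 * m)}
    (h : TrisectionKernels.Iso (N m) K) (M : Subgroup (SurfaceGroup (3 + 3 * m)))
    (hM : M.Characteristic) : ShadowStandardAt m K M := by
  obtain ⟨α, hα⟩ := h
  refine ⟨α, fun i => ?_⟩
  rw [Subgroup.map_sup, hα i, (characteristic_iff_map_eq.1 hM) α]

/-- **Why the crux resists.** A failure of `ShadowsStandard` exhibits a balanced group trisection
of the trivial group not isomorphic to the standard one at its genus (through Abrams–Gay–Kirby
Thm 5: an exotic 4-sphere, or a non-standard balanced trisection of `S⁴` against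
Meier–Schirmer–Zupan's Conj. 3.11); contrapositive of "unstable standardness implies the crux".
[folklore] -/
theorem exists_nonstandard_of_not_shadowsStandard (h : ¬ ShadowsStandard) :
    ∃ (m : ℕ) (K : TrisectionKernels (3 + 3 * m)),
      IsGroupTrisection (3 + 3 * m) (m + 1) (PUnit : Type) K ∧ ¬ TrisectionKernels.Iso (N m) K := by
  by_contra hne
  push Not at hne
  exact h fun m K hK M hM _ => ShadowStandardAt.of_iso (hne m K hK) M hM

/-! ## §2 The verbal levels `M_Q` and monotonicity -/

/-- The level subgroup of a target group `Q`: `M_Q = ⋂ {ker φ | φ : S_g →* Q}`. [folklore] -/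
def levelSubgroup (g : ℕ) (Q : Type*) [Group Q] : Subgroup (SurfaceGroup g) :=
  ⨅ φ : SurfaceGroup g →* Q, φ.ker

/-- `M_Q ≤ ker φ` for every `φ : S_g →* Q`. [folklore] -/
theorem levelSubgroup_le_ker {g : ℕ} {Q : Type*} [Group Q] (φ : SurfaceGroup g →* Q) :
    levelSubgroup g Q ≤ φ.ker :=
  iInf_le _ φ

/-- `M_Q` is characteristic (automorphisms permute `Hom(S, Q)`). [folklore] -/
theorem levelSubgroup_characteristic (g : ℕ) (Q : Type*) [Group Q] :
    (levelSubgroup g Q).Characteristic := by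
  rw [characteristic_iff_le_comap]
  intro ϕ x hx
  rw [mem_comap]
  refine mem_iInf.2 fun φ => ?_
  exact mem_iInf.1 hx (φ.comp ϕ.toMonoidHom)

/-- Homomorphisms out of `S_g` are determined by the `2g` generators, so `Hom(S_g, Q)` is finite
for finite `Q`. [folklore] -/
instance finite_hom (g : ℕ) (Q : Type*) [Group Q] [Finite Q] : Finite (SurfaceGroup g →* Q) :=
  Finite.of_injective (fun φ : SurfaceGroup g →* Q => fun x : surfaceGen g => φ (PresentedGroup.of x))
    fun _ _ h => PresentedGroup.ext fun x => congrFun h x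

/-- `M_Q` has finite index for finite `Q`. [folklore] -/
theorem levelSubgroup_finiteIndex (g : ℕ) (Q : Type*) [Group Q] [Finite Q] :
    (levelSubgroup g Q).FiniteIndex := by
  unfold levelSubgroup
  exact finiteIndex_iInf fun φ => inferInstance

/-- `M_{S/M} ≤ M`: the verbal levels are cofinal among normal finite-index subgroups. [folklore] -/
theorem levelSubgroup_quotient_le {g : ℕ} (M : Subgroup (SurfaceGroup g)) [M.Normal] :
    levelSubgroup g (SurfaceGroup g ⧸ M) ≤ M := by
  refine (levelSubgroup_le_ker (QuotientGroup.mk' M)).trans ?_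
  rw [QuotientGroup.ker_mk']

/-- **Monotonicity.** A standard shadow at level `M'` gives a standard shadow at every
characteristic level `M ⊇ M'` (no hypothesis on `M'`). [folklore] -/
theorem ShadowStandardAt.mono {m : ℕ} {K : TrisectionKernels (3 + 3 * m)}
    {M' M : Subgroup (SurfaceGroup (3 + 3 * m))} (hle : M' ≤ M) (hM : M.Characteristic)
    (h : ShadowStandardAt m K M') : ShadowStandardAt m K M := by
  obtain ⟨ψ, hψ⟩ := h
  refine ⟨ψ, fun i => ?_⟩
  have e1 : N m i ⊔ M = (N m i ⊔ M') ⊔ M := by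
    rw [sup_assoc, sup_eq_right.2 hle]
  have e2 : K i ⊔ M = (K i ⊔ M') ⊔ M := by
    rw [sup_assoc, sup_eq_right.2 hle]
  rw [e1, e2, Subgroup.map_sup, hψ i, (characteristic_iff_map_eq.1 hM) ψ]

/-- **Reduction to verbal levels (decl-free direction).** Standard shadows at all verbal levels
`M_Q`, `Q` finite (in `Type`), give standard shadows at every characteristic finite-index level.
[folklore] -/
theorem ShadowStandardAt.of_levels {m : ℕ} {K : TrisectionKernels (3 + 3 * m)}
    (h : ∀ (Q : Type) [Group Q] [Finite Q], ShadowStandardAt m K (levelSubgroup _ Q))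
    (M : Subgroup (SurfaceGroup (3 + 3 * m))) (hM : M.Characteristic) (hMf : M.FiniteIndex) :
    ShadowStandardAt m K M := by
  haveI := hMf
  haveI := hM
  haveI : M.Normal := inferInstance
  exact (h (SurfaceGroup (3 + 3 * m) ⧸ M)).mono (levelSubgroup_quotient_le M) hM

/-- **The crux implies its level form** (the form a refutation attacks: one finite `Q` suffices).
[folklore] -/
theorem shadowsStandard_levels (h : ShadowsStandard) (m : ℕ) (K : TrisectionKernels (3 + 3 * m))
    (hK : IsGroupTrisection (3 + 3 * m) (m + 1) (PUnit : Type) K) (Q : Type*) [Group Q] [Finite Q] :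
    ShadowStandardAt m K (levelSubgroup _ Q) :=
  h m K hK _ (levelSubgroup_characteristic _ Q) (levelSubgroup_finiteIndex _ Q)

/-! ## §3 The computable kill criterion: `Hom(S,Q)`-labellings -/

/-- **Kill criterion.** If the shadow of `K` at level `M_Q` is standard then precomposition with
the automorphism is a bijection `e` of `Hom(S_g, Q)` with `φ(Kᵢ) = (e φ)(Nᵢ)` for all `φ, i`: the
labelled sets `(Hom(S,Q), φ ↦ (φ(Kᵢ))ᵢ)` for `K` and for `N` are isomorphic. [folklore] -/
theorem homShadow_equiv_of_shadowStandardAt {m : ℕ} {K : TrisectionKernels (3 + 3 * m)}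
    {Q : Type*} [Group Q] (h : ShadowStandardAt m K (levelSubgroup _ Q)) :
    ∃ e : (SurfaceGroup (3 + 3 * m) →* Q) ≃ (SurfaceGroup (3 + 3 * m) →* Q),
      ∀ (φ : SurfaceGroup (3 + 3 * m) →* Q) (i : Fin 3),
        (K i).map φ = (N m i).map (e φ) := by
  obtain ⟨ψ, hψ⟩ := h
  refine ⟨⟨fun φ => φ.comp ψ.toMonoidHom, fun φ => φ.comp ψ.symm.toMonoidHom, fun φ => ?_,
    fun φ => ?_⟩, fun φ i => ?_⟩
  · ext x; simp
  · ext x; simp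
  · have hK : (levelSubgroup _ Q).map φ = ⊥ := (Subgroup.map_eq_bot_iff _).2 (levelSubgroup_le_ker φ)
    have hN : (levelSubgroup _ Q).map (φ.comp ψ.toMonoidHom) = ⊥ :=
      (Subgroup.map_eq_bot_iff _).2 (levelSubgroup_le_ker _)
    change (K i).map φ = (N m i).map (φ.comp ψ.toMonoidHom)
    calc (K i).map φ = (K i ⊔ levelSubgroup _ Q).map φ := by rw [Subgroup.map_sup, hK, sup_bot_eq]
      _ = ((N m i ⊔ levelSubgroup _ Q).map ψ.toMonoidHom).map φ := by rw [hψ i]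
      _ = (N m i).map (φ.comp ψ.toMonoidHom) := by rw [Subgroup.map_map, Subgroup.map_sup, hN, sup_bot_eq]

/-- **Counting form of the kill criterion.** Standard shadow at level `M_Q` forces, for every
target triple `T` of subgroups of `Q`, equality of the numbers of homomorphisms `S_g → Q` mapping
`(K₀,K₁,K₂)`, resp. `(N₀,N₁,N₂)`, exactly onto `T`. (By Möbius inversion over the subgroup
lattice this is the same information as the Hall-type counts `#{φ | φ(Kᵢ) ≤ Tᵢ}`.) A candidate
`K` and a finite `Q` with ONE differing count refute the crux via `shadowsStandard_iff_levels`. [folklore] -/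
theorem card_homShadow_eq {m : ℕ} {K : TrisectionKernels (3 + 3 * m)}
    {Q : Type*} [Group Q] (h : ShadowStandardAt m K (levelSubgroup _ Q))
    (T : Fin 3 → Subgroup Q) :
    Nat.card {φ : SurfaceGroup (3 + 3 * m) →* Q // ∀ i, (K i).map φ = T i} =
      Nat.card {φ : SurfaceGroup (3 + 3 * m) →* Q // ∀ i, (N m i).map φ = T i} := by
  obtain ⟨e, he⟩ := homShadow_equiv_of_shadowStandardAt h
  refine Nat.card_congr (e.subtypeEquiv fun φ => ?_)
  simp only [he]

/-! ## §4 Load-bearing hypotheses -/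

/-- The homomorphism `S_g →* Q` (`Q` commutative) with prescribed values on the generators. [folklore] -/
def abelianHom {g : ℕ} {Q : Type*} [CommGroup Q] (f : surfaceGen g → Q) : SurfaceGroup g →* Q :=
  PresentedGroup.toGroup (f := f) (by
    intro r hr
    rw [Set.mem_singleton_iff] at hr
    subst hr
    exact NilpotentShadowsStandard.Negative.lift_surfaceRelator_eq_one f)

/-- `abelianHom f` on a generator. [folklore] -/
@[simp] theorem abelianHom_of {g : ℕ} {Q : Type*} [CommGroup Q] (f : surfaceGen g → Q)
    (x : surfaceGen g) : abelianHom f (PresentedGroup.of x) = f x :=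
  PresentedGroup.toGroup.of _

/-- The character `χ_u : S_g → ℤ/2` that is `1` on the generator `u` and `0` on the others. [folklore] -/
def genChar {g : ℕ} (u : surfaceGen g) : SurfaceGroup g →* Multiplicative (ZMod 2) :=
  abelianHom fun x => if x = u then Multiplicative.ofAdd 1 else 1

/-- `χ_u(u) = 1 ∈ ℤ/2` (written multiplicatively). [folklore] -/
theorem genChar_of_self {g : ℕ} (u : surfaceGen g) :
    genChar u (PresentedGroup.of u) = Multiplicative.ofAdd 1 := by
  simp [genChar]

/-- `χ_u(x) = 0` for generators `x ≠ u`. [folklore] -/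
theorem genChar_of_ne {g : ℕ} {u x : surfaceGen g} (h : x ≠ u) :
    genChar u (PresentedGroup.of x) = 1 := by
  simp [genChar, h]

/-- The generator `u` is not in `ker χ_u`. [folklore] -/
theorem of_not_mem_ker_genChar {g : ℕ} (u : surfaceGen g) :
    (PresentedGroup.of u : SurfaceGroup g) ∉ (genChar u).ker := by
  rw [MonoidHom.mem_ker, genChar_of_self]
  decide

/-- Every generator of `S_3` lies in one of the three standard kernels, so the standard kernels
generate `S_3`. [folklore] -/
theorem iSup_s4Kernels_eq_top : (⨆ i, s4Kernels i) = ⊤ := by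
  rw [eq_top_iff, ← PresentedGroup.closure_range_of, closure_le]
  rintro _ ⟨x, rfl⟩
  obtain ⟨i, hi⟩ := s4Gens_cover x
  exact mem_iSup_of_mem i (of_mem_s4Kernels i hi)

/-- The level `M_{ℤ/2}` of `S_3` is a PROPER subgroup. [folklore] -/
theorem levelSubgroup_zmod2_ne_top : levelSubgroup 3 (Multiplicative (ZMod 2)) ≠ ⊤ := by
  intro h
  have hmem : (PresentedGroup.of ((0 : Fin 3), true) : SurfaceGroup 3) ∈
      levelSubgroup 3 (Multiplicative (ZMod 2)) := by rw [h]; exact mem_top _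
  exact of_not_mem_ker_genChar _ (levelSubgroup_le_ker (genChar ((0 : Fin 3), true)) hmem)

/-- **`IsGroupTrisection` is load-bearing**: for the junk triple `K = ⊥` at `m = 0` and the proper
characteristic finite-index level `M = M_{ℤ/2}`, a standard shadow would force `Nᵢ ≤ M` for all
`i`, hence `M = ⊤`. [folklore] -/
theorem shadowsStandard_false_without_trisection :
    ¬ ∀ (m : ℕ) (K : TrisectionKernels (3 + 3 * m)) (M : Subgroup (SurfaceGroup (3 + 3 * m))),
        M.Characteristic → M.FiniteIndex → ShadowStandardAt m K M := by
  intro h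
  obtain ⟨ψ, hψ⟩ := h 0 (fun _ => ⊥) (levelSubgroup 3 (Multiplicative (ZMod 2)))
    (levelSubgroup_characteristic 3 _) (levelSubgroup_finiteIndex 3 _)
  apply levelSubgroup_zmod2_ne_top
  rw [eq_top_iff, ← iSup_s4Kernels_eq_top, iSup_le_iff]
  intro i
  have hi := hψ i
  rw [bot_sup_eq] at hi
  have key : s4Kernels i ⊔ levelSubgroup 3 (Multiplicative (ZMod 2)) =
      levelSubgroup 3 (Multiplicative (ZMod 2)) := by
    have := congrArg (Subgroup.comap ψ.toMonoidHom) hi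
    rwa [comap_map_eq_self_of_injective ψ.injective,
      (levelSubgroup_characteristic 3 (Multiplicative (ZMod 2))).fixed ψ] at this
  exact le_sup_left.trans key.le

/-- **`FiniteIndex` is load-bearing but not refutable here**: without it the statement is
EQUIVALENT to the unstable standardness of every balanced group trisection of `{1}` (`Iso N K`; take `M = ⊥`), i.e. to SPC4 ∧ balanced 4-d Waldhausen in AGK's dictionary. [folklore] -/
theorem shadowsStandard_without_finiteIndex_iff_unstable :
    (∀ (m : ℕ) (K : TrisectionKernels (3 + 3 * m)),
      IsGroupTrisection (3 + 3 * m) (m + 1) (PUnit : Type) K →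
      ∀ M : Subgroup (SurfaceGroup (3 + 3 * m)), M.Characteristic → ShadowStandardAt m K M) ↔
    (∀ (m : ℕ) (K : TrisectionKernels (3 + 3 * m)),
      IsGroupTrisection (3 + 3 * m) (m + 1) (PUnit : Type) K → TrisectionKernels.Iso (N m) K) := by
  constructor
  · intro h m K hK
    obtain ⟨ψ, hψ⟩ := h m K hK ⊥ Subgroup.botCharacteristic
    exact ⟨ψ, fun i => by simpa using hψ i⟩
  · intro h m K hK M hM
    exact ShadowStandardAt.of_iso (h m K hK) M hM

/-- Relabelling the three kernels of a group trisection gives a group trisection. [folklore] -/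
theorem isGroupTrisection_reindex {g k : ℕ} {G : Type*} [Group G] {K : TrisectionKernels g}
    (hK : IsGroupTrisection g k G K) (σ : Equiv.Perm (Fin 3)) :
    IsGroupTrisection g k G (K ∘ σ) where
  normal i := hK.normal (σ i)
  free_quotient i := hK.free_quotient (σ i)
  free_pairQuotient i j hij := hK.free_pairQuotient (σ i) (σ j) (σ.injective.ne hij)
  triple := by
    obtain ⟨e⟩ := hK.triple
    have hU : (⋃ i, ((K ∘ σ) i : Set (SurfaceGroup g))) = ⋃ i, (K i : Set (SurfaceGroup g)) :=
      σ.surjective.iUnion_comp fun i => (K i : Set (SurfaceGroup g))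
    exact ⟨(QuotientGroup.quotientMulEquivOfEq (congrArg normalClosure hU)).trans e⟩

/-- The relabelled standard triple `N ∘ finRotate 3 = (N₁, N₂, N₀)` of genus `3`. [folklore] -/
def rotatedKernels : TrisectionKernels 3 := s4Kernels ∘ finRotate 3

/-- The relabelled standard triple is a `(3,1)` group trisection of the trivial group. [folklore] -/
theorem rotatedKernels_isGroupTrisection : IsGroupTrisection 3 1 (PUnit : Type) rotatedKernels :=
  isGroupTrisection_reindex s4Kernels_isGroupTrisection_holds _

/-- `N₀ = ⟪a₁, a₂, b₃⟫` dies under the character of `b₂`. [folklore] -/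
theorem s4Kernels_zero_le_ker : s4Kernels 0 ≤ (genChar (((1 : Fin 3), true) : surfaceGen 3)).ker := by
  rw [s4Kernels_eq]
  refine normalClosure_le_normal ?_
  rintro _ ⟨x, hx, rfl⟩
  rw [SetLike.mem_coe, MonoidHom.mem_ker]
  refine genChar_of_ne ?_
  rintro rfl
  revert hx
  decide

/-- `N₁ ⊔ ker χ_{b₂} = ⊤`: `b₂ ∈ N₁ = ⟪a₁, b₂, a₃⟫`, every other generator dies under `χ_{b₂}`. [folklore] -/
theorem s4Kernels_one_sup_ker_eq_top :
    s4Kernels 1 ⊔ (genChar (((1 : Fin 3), true) : surfaceGen 3)).ker = ⊤ := by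
  rw [eq_top_iff, ← PresentedGroup.closure_range_of, closure_le]
  rintro _ ⟨x, rfl⟩
  by_cases hx : x = ((1 : Fin 3), true)
  · subst hx
    exact mem_sup_left (of_mem_s4Kernels 1 (by decide))
  · exact mem_sup_right (by rw [MonoidHom.mem_ker]; exact genChar_of_ne hx)

/-- **`Characteristic` is load-bearing**: for the relabelled STANDARD trisection
`K = (N₁, N₂, N₀)` (isomorphic to `N`, so all its characteristic shadows are standard) and the
non-characteristic index-2 level `M = ker χ_{b₂}`, no automorphism works: at `i = 0` the left
side `ψ(N₀ ⊔ M) = ψ(M)` is proper while the right side `N₁ ⊔ M` is everything. [folklore] -/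
theorem shadowsStandard_false_without_characteristic :
    ¬ ∀ (m : ℕ) (K : TrisectionKernels (3 + 3 * m)),
        IsGroupTrisection (3 + 3 * m) (m + 1) (PUnit : Type) K →
        ∀ M : Subgroup (SurfaceGroup (3 + 3 * m)), M.FiniteIndex → ShadowStandardAt m K M := by
  intro h
  obtain ⟨ψ, hψ⟩ := h 0 rotatedKernels rotatedKernels_isGroupTrisection
    (genChar (((1 : Fin 3), true) : surfaceGen 3)).ker inferInstance
  have h0 := hψ 0
  have hl : s4Kernels.stabilizeIter 0 0 ⊔ (genChar (((1 : Fin 3), true) : surfaceGen 3)).ker =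
      (genChar (((1 : Fin 3), true) : surfaceGen 3)).ker :=
    sup_eq_right.2 s4Kernels_zero_le_ker
  have hr : rotatedKernels 0 ⊔ (genChar (((1 : Fin 3), true) : surfaceGen 3)).ker = ⊤ :=
    s4Kernels_one_sup_ker_eq_top
  rw [hl, hr] at h0
  have htop : (genChar (((1 : Fin 3), true) : surfaceGen 3)).ker = ⊤ := by
    have := congrArg (Subgroup.comap ψ.toMonoidHom) h0
    rwa [comap_map_eq_self_of_injective ψ.injective, comap_top] at this
  exact of_not_mem_ker_genChar _ (htop ▸ mem_top (PresentedGroup.of (((1 : Fin 3), true) : surfaceGen 3)))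

/-! ## §5 Natural strengthenings -/

/-- The uniform strengthening "one automorphism for all levels" is literally unstable standardness
(specialise to `M = ⊥`); recorded as an `Iff` with the `M`-uniform statement. [folklore] -/
theorem shadowsStandard_uniform_iff_unstable :
    (∀ (m : ℕ) (K : TrisectionKernels (3 + 3 * m)),
      IsGroupTrisection (3 + 3 * m) (m + 1) (PUnit : Type) K →
      ∃ ψ : SurfaceGroup (3 + 3 * m) ≃* SurfaceGroup (3 + 3 * m),
        ∀ M : Subgroup (SurfaceGroup (3 + 3 * m)), M.Characteristic →
          ∀ i : Fin 3, (N m i ⊔ M).map ψ.toMonoidHom = K i ⊔ M) ↔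
    (∀ (m : ℕ) (K : TrisectionKernels (3 + 3 * m)),
      IsGroupTrisection (3 + 3 * m) (m + 1) (PUnit : Type) K → TrisectionKernels.Iso (N m) K) := by
  constructor
  · intro h m K hK
    obtain ⟨ψ, hψ⟩ := h m K hK
    exact ⟨ψ, fun i => by simpa using hψ ⊥ Subgroup.botCharacteristic i⟩
  · intro h m K hK
    obtain ⟨α, hα⟩ := h m K hK
    exact ⟨α, fun M hM i => by rw [Subgroup.map_sup, hα i, (characteristic_iff_map_eq.1 hM) α]⟩

end Summit.SmoothPoincare4.SmoothPoincare4.Theorems.ShadowsStandard.Negative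

end
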